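import Mathlib.NumberTheory.SmoothNumbers
import Mathlib.Data.Nat.Factorization.Basic
import HarnessLib

/-!
# The `B`-smooth part of an integer

Topic `Literature/NumberTheory/Sieve` (elementary multiplicative bookkeeping used in the
`Σ₀`-estimate of Bombieri's asymptotic sieve, [FriedlanderIwaniecPisa1978] §6, proof of Lemma 24:
"For `n` a positive integer, write `n = n₁ n₂` where all the prime factors of `n₁` are `< ζ`,
while those of `n₂` are `> ζ`"). We define `smoothPart B n = n₁ = ∏_{p ∣ n, p < B} p^{v_p(n)}`
and prove the basic API: its factorization, `n₁ ∣ n`, `n₁` is `B`-smooth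
(`Nat.smoothNumbers B`), no prime `< B` divides `n / n₁`, and uniqueness of the decomposition.

## References

* J. Friedlander, H. Iwaniec, *On Bombieri's asymptotic sieve*, Ann. SNS Pisa (4) 5 (1978),
  §6 (p. 748).
-/

open Finset

namespace Literature.NumberTheory.Sieve

/-- The **`B`-smooth part** of `n`: `smoothPart B n = ∏_{p ∣ n, p < B} p^{v_p(n)}` (the `n₁` of
[FriedlanderIwaniecPisa1978] p. 748 with `ζ = B`; for `n = 0` the empty product `1`).
[cite: FriedlanderIwaniecPisa1978, §6 (p. 748, n = n₁ n₂)] -/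
def smoothPart (B n : ℕ) : ℕ :=
  ∏ p ∈ n.primeFactors.filter (fun p : ℕ => p < B), p ^ n.factorization p

/-- Unfolding lemma (definition). [folklore] -/
theorem smoothPart_def (B n : ℕ) :
    smoothPart B n = ∏ p ∈ n.primeFactors.filter (fun p : ℕ => p < B), p ^ n.factorization p :=
  rfl

/-- `smoothPart B n ≠ 0` (a product of prime powers). [folklore] -/
theorem smoothPart_ne_zero (B n : ℕ) : smoothPart B n ≠ 0 :=
  Finset.prod_ne_zero_iff.mpr fun _ hp =>
    pow_ne_zero _ (Nat.prime_of_mem_primeFactors (Finset.mem_filter.mp hp).1).ne_zero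

/-- **The factorization of the smooth part**: `v_p(smoothPart B n) = v_p(n)` for `p < B` and `0`
otherwise. [folklore] -/
theorem factorization_smoothPart (B n p : ℕ) :
    (smoothPart B n).factorization p = if p < B then n.factorization p else 0 := by
  rw [smoothPart, Nat.factorization_prod fun q hq =>
    pow_ne_zero _ (Nat.prime_of_mem_primeFactors (Finset.mem_filter.mp hq).1).ne_zero]
  rw [Finsupp.finsetSum_apply]
  have h : ∀ q ∈ n.primeFactors.filter (fun q : ℕ => q < B),
      (q ^ n.factorization q).factorization p = if q = p then n.factorization p else 0 := by
    intro q hq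
    have hqp : q.Prime := Nat.prime_of_mem_primeFactors (Finset.mem_filter.mp hq).1
    rw [hqp.factorization_pow, Finsupp.single_apply]
    split_ifs with h1
    · subst h1; rfl
    · rfl
  rw [Finset.sum_congr rfl h, Finset.sum_ite_eq']
  by_cases hpB : p < B
  · rw [if_pos hpB]
    split_ifs with hmem
    · rfl
    · -- `p ∉ primeFactors n` (with `p < B`): then `v_p(n) = 0`
      symm
      rw [Finset.mem_filter, not_and_or] at hmem
      rcases hmem with h1 | h1
      · exact Finsupp.notMem_support_iff.mp (by rwa [Nat.support_factorization])
      · exact absurd hpB h1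
  · rw [if_neg hpB, if_neg]
    exact fun hmem => hpB (Finset.mem_filter.mp hmem).2

/-- `smoothPart B n ∣ n` for `n ≠ 0`. [folklore] -/
theorem smoothPart_dvd {n : ℕ} (hn : n ≠ 0) (B : ℕ) : smoothPart B n ∣ n := by
  rw [← Nat.factorization_le_iff_dvd (smoothPart_ne_zero B n) hn]
  intro p
  rw [factorization_smoothPart]
  split_ifs
  · exact le_rfl
  · exact Nat.zero_le _

/-- The smooth part is `B`-smooth: all its prime factors are `< B`. [folklore] -/
theorem smoothPart_mem_smoothNumbers (B n : ℕ) : smoothPart B n ∈ Nat.smoothNumbers B := by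
  rw [Nat.mem_smoothNumbers']
  intro p hp hpd
  by_contra hpB
  have h1 : 1 ≤ (smoothPart B n).factorization p :=
    hp.factorization_pos_of_dvd (smoothPart_ne_zero B n) hpd
  rw [factorization_smoothPart, if_neg hpB] at h1
  exact Nat.not_succ_le_zero 0 h1

/-- For a prime `p < B`: `p ∣ smoothPart B n ↔ p ∣ n` (`n ≠ 0`). [folklore] -/
theorem prime_dvd_smoothPart_iff {p B n : ℕ} (hp : p.Prime) (hpB : p < B) (hn : n ≠ 0) :
    p ∣ smoothPart B n ↔ p ∣ n := by
  rw [hp.dvd_iff_one_le_factorization (smoothPart_ne_zero B n),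
    hp.dvd_iff_one_le_factorization hn, factorization_smoothPart, if_pos hpB]

/-- No prime `< B` divides the cofactor `n / smoothPart B n` (`n ≠ 0`). [folklore] -/
theorem not_dvd_div_smoothPart {p B n : ℕ} (hp : p.Prime) (hpB : p < B) (hn : n ≠ 0) :
    ¬ p ∣ n / smoothPart B n := by
  rw [hp.dvd_iff_one_le_factorization (Nat.div_ne_zero_iff_of_dvd (smoothPart_dvd hn B)
    |>.mpr ⟨hn, smoothPart_ne_zero B n⟩), Nat.factorization_div (smoothPart_dvd hn B),
    Finsupp.tsub_apply, factorization_smoothPart, if_pos hpB, Nat.sub_self]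
  exact Nat.not_succ_le_zero 0

/-- The smooth part and its cofactor are coprime (`n ≠ 0`). [folklore] -/
theorem coprime_smoothPart_div {B n : ℕ} (hn : n ≠ 0) :
    (smoothPart B n).Coprime (n / smoothPart B n) := by
  refine Nat.coprime_of_dvd fun p hp hps hpc => ?_
  have hpB : p < B := (Nat.mem_smoothNumbers'.mp (smoothPart_mem_smoothNumbers B n)) p hp hps
  exact not_dvd_div_smoothPart hp hpB hn hpc

/-- `smoothPart B n * (n / smoothPart B n) = n` (`n ≠ 0`). [folklore] -/
theorem smoothPart_mul_div {n : ℕ} (hn : n ≠ 0) (B : ℕ) :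
    smoothPart B n * (n / smoothPart B n) = n :=
  Nat.mul_div_cancel' (smoothPart_dvd hn B)

/-- **Uniqueness of the decomposition**: if `q` is `B`-smooth and no prime `< B` divides `r ≠ 0`,
then `smoothPart B (q r) = q`. [folklore] -/
theorem smoothPart_mul_eq {B q r : ℕ} (hq : q ∈ Nat.smoothNumbers B) (hr : r ≠ 0)
    (hrB : ∀ p : ℕ, p.Prime → p < B → ¬ p ∣ r) : smoothPart B (q * r) = q := by
  have hq0 : q ≠ 0 := Nat.ne_zero_of_mem_smoothNumbers hq
  refine Nat.eq_of_factorization_eq (smoothPart_ne_zero B _) hq0 fun p => ?_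
  rw [factorization_smoothPart, Nat.factorization_mul hq0 hr, Finsupp.add_apply]
  by_cases hp : p.Prime
  · split_ifs with hpB
    · rw [Nat.factorization_eq_zero_of_not_dvd (hrB p hp hpB), add_zero]
    · -- `p ≥ B` does not divide the `B`-smooth `q`
      symm
      refine Nat.factorization_eq_zero_of_not_dvd fun hpq => hpB ?_
      exact (Nat.mem_smoothNumbers'.mp hq) p hp hpq
  · simp [Nat.factorization_eq_zero_of_not_prime _ hp]

/-- In particular `smoothPart B (smoothPart B n · (n / smoothPart B n))`-style idempotence:
`smoothPart B n = q` iff `n = q r` with `q` `B`-smooth and `r` free of primes `< B`; here the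
useful direction: the cofactor of any `n ≠ 0` with `smoothPart B n = q` is `n / q`, free of primes
`< B`, and `q` is `B`-smooth (restating the API for `q = smoothPart B n`). [folklore] -/
theorem smoothPart_eq_iff {B n q : ℕ} (hn : n ≠ 0) :
    smoothPart B n = q ↔ q ∈ Nat.smoothNumbers B ∧ q ∣ n ∧
      ∀ p : ℕ, p.Prime → p < B → ¬ p ∣ n / q := by
  constructor
  · rintro rfl
    exact ⟨smoothPart_mem_smoothNumbers B n, smoothPart_dvd hn B,
      fun p hp hpB => not_dvd_div_smoothPart hp hpB hn⟩
  · rintro ⟨hq, hqn, hr⟩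
    have hq0 : q ≠ 0 := Nat.ne_zero_of_mem_smoothNumbers hq
    have hr0 : n / q ≠ 0 := (Nat.div_ne_zero_iff_of_dvd hqn).mpr ⟨hn, hq0⟩
    have := smoothPart_mul_eq hq hr0 hr
    rwa [Nat.mul_div_cancel' hqn] at this

end Literature.NumberTheory.Sieve
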